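import Summits.BirchSwinnertonDyer.BirchSwinnertonDyer.Theorems.TameQuarticSolventTprimeFormalGroupCongruenceAtThree
import HarnessLib

/-!
# Route `TameQuarticSolvent`, crux `SolventPairLowerBound` (stmt-BirchSwinnertonDyer-21391) — the FORMAL-GROUP
# DICHOTOMY of the (t′) leaf from `ℚ`: Kobayashi's congruence on the good model over the quartic ring holds in
# case B of the Hodge split and fails at `t³` in case A

HONEST FRAMING. Theorems only; helper (`--supports stmt-BirchSwinnertonDyer-21391 --as helper`) of width seat
bsd-wall-tqs-p1-w3 g5; sequel of `TameQuarticSolventTprimeFormalGroupCongruenceAtThree` (ring-level) and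
`TameQuarticSolventTprimeHodgeSplitAtThree` (p595856). BSD is not proved by any of this; nothing here closes 21391
or 23963 — it types the first local input a signed theory over the solvent quartic field would consume, and says
on which sub-row of the leaf it is available.

WHAT. `tprime_goodModel_formalMul_three_dichotomy` — for `W/ℚ` globally minimal, elliptic, `Addv W 3`,
`SubTprime W 3`, and any commutative ring `O` with `φ : ℤ₃ → O`, `3 = ϖ⁴u`, `u ∈ Oˣ`, `ϖ ∉ Oˣ`: the `ℤ₃` medium
form `T • V` of `W ⊗ ℚ₃` (`k = 1`, `m = 3` for `III`; `k = 3`, `m = 6` for `III*`; `ord₃ Δ = 3k`) has a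
`ϖᵏ`-rescaled model `W'` over `O` with unit discriminant and EITHER (case B: `c₆ = 0 ∨ ord₃ c₆ ≥ m + 2`)
`3 ∣ a₂(W')` and `[3]_{W'}(t) ≡ h(t⁹) (mod 3O)`, OR (case A: `ord₃ c₆ = m`) `a₂(W') = ϖ²·(unit)` and
`c₃([3]_{W'}) ≡ 4a₂(W') (mod 3O)`. Census (memo `Cruxes/SolventPairLowerBound/TPRIME-LOCAL-SHAPE-w3g5.md`):
case A 6 605 / case B 1 058 of the 7 663 (t′) classes with `N < 5·10⁵`.

References: J. H. Silverman, *AEC* IV.4.4, IV.7.5, VII.1; J.-P. Serre, Driebergen 1966 §5 Lemme 3; S. Kobayashi,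
Invent. Math. 152 (2003) §8. [cite: SilvermanAEC2009, IV.7.5] [cite: Serre1967GroupesPDivisibles, §5 Lemme 3]
-/

-- D-0017: single-problem summit, so `Summit.BirchSwinnertonDyer.BirchSwinnertonDyer.…` repeats a namespace BY DESIGN.
set_option linter.dupNamespace false

noncomputable section

open IsLocalRing IsDedekindDomain
open IsDiscreteValuationRing hiding maximalIdeal
open Literature Literature.NumberTheory.DiophantineGeometry
  Literature.NumberTheory.DiophantineGeometry.TateAlgorithm
  Literature.NumberTheory.EllipticCurves

namespace Summit.BirchSwinnertonDyer.BirchSwinnertonDyer.Theorems.SolventPairLowerBound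

/-! ## The dichotomy from `ℚ` -/

section RatLevel

open Literature.NumberTheory.EllipticCurves.Rizzo Literature.NumberTheory.EllipticCurves.Rank1Residual
  Summit.BirchSwinnertonDyer.Rank1Residual.Additive

variable (W : WeierstrassCurve ℚ) [W.IsElliptic] [W.IsGloballyMinimal]

/-- **The formal-group dichotomy of the (t′) leaf.** For `W/ℚ` globally minimal, elliptic, `Addv W 3`,
`SubTprime W 3`, and ANY commutative ring `O` with a map `φ : ℤ₃ → O` in which `3 = ϖ⁴u`, `u ∈ Oˣ`, `ϖ ∉ Oˣ`
(the valuation ring at a place `w ∣ 3` with `e(w|3) = 4` of the solvent quartic field, a uniformiser, …): the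
`ℤ₃` medium form `T • V` of `W ⊗ ℚ₃` (`exists_padicInt_mediumForm_of_subTprime`; `k = 1` for `III`, `k = 3` for
`III*`; `m = 3` resp. `6`; `ord₃ Δ = 3k`) has a `ϖᵏ`-RESCALED model `W'` over `O` with UNIT discriminant, and EITHER (case B:
`c₆ = 0 ∨ ord₃ c₆ ≥ m + 2`) `3 ∣ a₂(W')` and `[3]_{W'}(t) ≡ h(t⁹) (mod 3O)`, OR (case A: `ord₃ c₆ = m`)
`a₂(W') = ϖ²·(unit)` and `c₃([3]_{W'}) ≡ 4a₂(W') ≢ 0 (mod 3O)`-shape. The case is the Hodge split of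
`tprime_padicValRat_c₆_split` (p595856). [cite: SilvermanAEC2009, IV.7.5 and VII.1]
[cite: Serre1967GroupesPDivisibles, §5 Lemme 3] -/
theorem tprime_goodModel_formalMul_three_dichotomy (hadd : Addv W 3) (hsub : SubTprime W 3)
    {O : Type*} [CommRing O] (φ : ℤ_[3] →+* O) {ϖ u : O} (hu : IsUnit u) (h3 : (3 : O) = ϖ ^ 4 * u)
    (hϖ : ¬ IsUnit ϖ) :
    ∃ (V : WeierstrassCurve ℤ_[3]) (T : WeierstrassCurve.VariableChange ℤ_[3]) (k m : ℕ)
      (W' : WeierstrassCurve O),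
      V.map (algebraMap ℤ_[3] ℚ_[3]) = W.baseChange ℚ_[3] ∧ ((k = 1 ∧ m = 3) ∨ (k = 3 ∧ m = 6)) ∧
      padicValRat 3 W.Δ = 3 * k ∧ (T • V).a₁ = 0 ∧ (T • V).a₃ = 0 ∧ W'.a₁ = 0 ∧ W'.a₃ = 0 ∧
      ϖ ^ (2 * k) * W'.a₂ = φ (T • V).a₂ ∧ ϖ ^ (4 * k) * W'.a₄ = φ (T • V).a₄ ∧
      ϖ ^ (6 * k) * W'.a₆ = φ (T • V).a₆ ∧ IsUnit W'.Δ ∧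
      ((((3 : O) ∣ W'.a₂) ∧ (W.c₆ = 0 ∨ (m + 2 : ℤ) ≤ padicValRat 3 W.c₆) ∧
          ∀ n : ℕ, ¬ 9 ∣ n → PowerSeries.coeff n (W'.formalMul 3) ∈ Ideal.span {(3 : O)}) ∨
        ((∃ s₀ : O, IsUnit s₀ ∧ W'.a₂ = ϖ ^ 2 * s₀) ∧ (W.c₆ ≠ 0 ∧ padicValRat 3 W.c₆ = m) ∧
          PowerSeries.coeff 3 (W'.formalMul 3) - 4 * W'.a₂ ∈ Ideal.span {(3 : O)})) := by
  classical
  obtain ⟨T, V, hVmap, hA₁, hA₃, hcases⟩ := exists_padicInt_mediumForm_of_subTprime W hadd hsub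
  have h2 : IsUnit (2 : ℤ_[3]) := isUnit_two_padicInt_three
  have h3i : Irreducible (3 : ℤ_[3]) := by simpa using PadicInt.irreducible_p (p := 3)
  set S := T • V with hS
  -- transport of valuations from `S` to `W` (as in `tprime_padicValRat_c₆_split`)
  have haddu : addVal ℤ_[3] ((T.u⁻¹ : ℤ_[3]ˣ) : ℤ_[3]) = 0 :=
    addVal_def ((T.u⁻¹ : ℤ_[3]ˣ) : ℤ_[3]) T.u⁻¹ h3i 0 (by rw [pow_zero, mul_one])
  have hSΔ : S.Δ = ((T.u⁻¹ : ℤ_[3]ˣ) : ℤ_[3]) ^ 12 * V.Δ := by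
    rw [hS, WeierstrassCurve.variableChange_Δ]
  have hSc₆ : S.c₆ = ((T.u⁻¹ : ℤ_[3]ˣ) : ℤ_[3]) ^ 6 * V.c₆ := by
    rw [hS, WeierstrassCurve.variableChange_c₆]
  have hvalSΔ : (addVal ℤ_[3] S.Δ).toNat = (addVal ℤ_[3] V.Δ).toNat := by
    rw [hSΔ, addVal_mul, addVal_pow, haddu]; simp
  have hvalSc₆ : (addVal ℤ_[3] S.c₆).toNat = (addVal ℤ_[3] V.c₆).toNat := by
    rw [hSc₆, addVal_mul, addVal_pow, haddu]; simp
  have hVΔ : ((V.Δ : ℤ_[3]) : ℚ_[3]) = (W.Δ : ℚ_[3]) := by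
    have h := congrArg WeierstrassCurve.Δ hVmap
    rw [WeierstrassCurve.map_Δ, WeierstrassCurve.baseChange, WeierstrassCurve.map_Δ, eq_ratCast] at h
    exact h
  have hVc₆ : ((V.c₆ : ℤ_[3]) : ℚ_[3]) = (W.c₆ : ℚ_[3]) := by
    have h := congrArg WeierstrassCurve.c₆ hVmap
    rw [WeierstrassCurve.map_c₆, WeierstrassCurve.baseChange, WeierstrassCurve.map_c₆, eq_ratCast] at h
    exact h
  have hWΔval : padicValRat 3 W.Δ = ((addVal ℤ_[3] S.Δ).toNat : ℤ) := by
    have h := congrArg Padic.valuation hVΔ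
    rw [PadicInt.valuation_coe, Padic.valuation_ratCast] at h
    rw [hvalSΔ, addVal_toNat_eq_valuation]; exact h.symm
  have hWc₆val : padicValRat 3 W.c₆ = ((addVal ℤ_[3] S.c₆).toNat : ℤ) := by
    have h := congrArg Padic.valuation hVc₆
    rw [PadicInt.valuation_coe, Padic.valuation_ratCast] at h
    rw [hvalSc₆, addVal_toNat_eq_valuation]; exact h.symm
  have hc₆0 : W.c₆ = 0 ↔ S.c₆ = 0 := by
    rw [hSc₆, mul_eq_zero, or_iff_right (pow_ne_zero _ (Units.ne_zero _)), ← PadicInt.coe_eq_zero, hVc₆,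
      Rat.cast_eq_zero]
  have hlt : ∀ {m : ℕ}, ¬ (3 : ℤ_[3]) ^ m ∣ S.c₆ → S.c₆ ≠ 0 ∧ (addVal ℤ_[3] S.c₆).toNat < m := by
    intro m hnd
    have hS0 : S.c₆ ≠ 0 := fun h ↦ hnd (by rw [h]; exact dvd_zero _)
    refine ⟨hS0, ?_⟩
    rw [pow_dvd_iff_le_addVal_of_irreducible h3i, not_le] at hnd
    have hne : addVal ℤ_[3] S.c₆ ≠ ⊤ := by rwa [Ne, addVal_eq_top_iff]
    rw [← ENat.coe_toNat hne] at hnd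
    exact_mod_cast hnd
  have hge : ∀ {m : ℕ}, (3 : ℤ_[3]) ^ m ∣ S.c₆ → W.c₆ = 0 ∨ (m : ℤ) ≤ padicValRat 3 W.c₆ := by
    intro m hd
    by_cases hc : W.c₆ = 0
    · exact Or.inl hc
    · have h := le_addVal_toNat_of_pow_dvd h3i (fun h ↦ hc (hc₆0.mpr h)) hd
      rw [hWc₆val]
      exact Or.inr (by exact_mod_cast h)
  rcases hcases with ⟨h₂, h₄, -, h₆, hv⟩ | ⟨h₂, h₄, -, h₆, hv⟩
  · -- Kodaira `III`, `k = 1`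
    have hΔ3 : padicValRat 3 W.Δ = 3 * (1 : ℕ) := by rw [hWΔval, hv]; norm_num
    by_cases h9 : (3 : ℤ_[3]) ^ 2 ∣ S.a₂
    · obtain ⟨W', h1', h3', r2, r4, r6, hU, hd2, hcong⟩ :=
        tprime_caseB_goodModel_formalMul_three φ hu h3 hϖ S hA₁ hA₃ h9 h₄ h₆ hv
      refine ⟨V, T, 1, 3, W', hVmap, Or.inl ⟨rfl, rfl⟩, hΔ3, hA₁, hA₃, h1', h3', by simpa using r2,
        by simpa using r4, by simpa using r6, hU, Or.inl ⟨hd2, ?_, hcong⟩⟩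
      have := hge (pow_five_dvd_c₆_of_mediumForm_III S hA₁ hA₃ h9 h₄ h₆)
      simpa using this
    · obtain ⟨W', h1', h3', r2, r4, r6, hU, hs₀, hcong⟩ :=
        tprime_caseA_goodModel_coeff_three φ hu h3 S hA₁ hA₃ h₂ h9 h₄ h₆ hv
      refine ⟨V, T, 1, 3, W', hVmap, Or.inl ⟨rfl, rfl⟩, hΔ3, hA₁, hA₃, h1', h3', by simpa using r2,
        by simpa using r4, by simpa using r6, hU, Or.inr ⟨hs₀, ?_, hcong⟩⟩
      obtain ⟨hS0, hlt4⟩ := hlt (not_pow_four_dvd_c₆_of_mediumForm_III h2 h3i S hA₁ hA₃ h₂ h9 h₄ h₆)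
      have h3le := le_addVal_toNat_of_pow_dvd h3i hS0
        (pow_three_dvd_c₆_of_mediumForm_III S hA₁ hA₃ h₂ h₄ h₆)
      refine ⟨fun h ↦ hS0 (hc₆0.mp h), ?_⟩
      rw [hWc₆val]
      have : (addVal ℤ_[3] S.c₆).toNat = 3 := by omega
      exact_mod_cast this
  · -- Kodaira `III*`, `k = 3`
    have hΔ9 : padicValRat 3 W.Δ = 3 * (3 : ℕ) := by rw [hWΔval, hv]; norm_num
    by_cases h27 : (3 : ℤ_[3]) ^ 3 ∣ S.a₂
    · obtain ⟨W', h1', h3', r2, r4, r6, hU, hd2, hcong⟩ :=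
        tprime_caseB_goodModel_formalMul_three_IIIstar φ hu h3 hϖ S hA₁ hA₃ h27 h₄ h₆ hv
      refine ⟨V, T, 3, 6, W', hVmap, Or.inr ⟨rfl, rfl⟩, hΔ9, hA₁, hA₃, h1', h3', by simpa using r2,
        by simpa using r4, by simpa using r6, hU, Or.inl ⟨hd2, ?_, hcong⟩⟩
      have := hge (pow_eight_dvd_c₆_of_mediumForm_IIIstar S hA₁ hA₃ h27 h₄ h₆)
      simpa using this
    · obtain ⟨W', h1', h3', r2, r4, r6, hU, hs₀, hcong⟩ :=
        tprime_caseA_goodModel_coeff_three_IIIstar φ hu h3 S hA₁ hA₃ h₂ h27 h₄ h₆ hv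
      refine ⟨V, T, 3, 6, W', hVmap, Or.inr ⟨rfl, rfl⟩, hΔ9, hA₁, hA₃, h1', h3', by simpa using r2,
        by simpa using r4, by simpa using r6, hU, Or.inr ⟨hs₀, ?_, hcong⟩⟩
      obtain ⟨hS0, hlt7⟩ :=
        hlt (not_pow_seven_dvd_c₆_of_mediumForm_IIIstar h2 h3i S hA₁ hA₃ h₂ h27 h₄ h₆)
      have h6le := le_addVal_toNat_of_pow_dvd h3i hS0
        (pow_six_dvd_c₆_of_mediumForm_IIIstar S hA₁ hA₃ h₂ h₄ h₆)
      refine ⟨fun h ↦ hS0 (hc₆0.mp h), ?_⟩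
      rw [hWc₆val]
      have : (addVal ℤ_[3] S.c₆).toNat = 6 := by omega
      exact_mod_cast this

end RatLevel

end Summit.BirchSwinnertonDyer.BirchSwinnertonDyer.Theorems.SolventPairLowerBound

end
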